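import Summits.AtomisticToContinuum.HydrodynamicLimit.Theorems.EquilibriumClampedCollisionalWindowLD.Negative.PulseStep

/-!
# Cradle pulse: coarse position bounds and separation of non-adjacent spheres (helper file of the refutation of `EquilibriumClampedCollisionalWindowLD`, stmt-AtomisticToContinuum-13733; see `Cruxes/EquilibriumClampedCollisionalWindowLD/Disproof.lean` and the evidence WITNESS.md; no Theses declaration is asserted positively; refuter-cdisprove-stmt-AtomisticToContinuum-13733-0)
-/

noncomputable section

open Real
open scoped InnerProductSpace

namespace Summit.AtomisticToContinuum.HydrodynamicLimit.Theorems

namespace EquilibriumClampedCollisionalWindowLDNegative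

section BlockAll

variable {E : Type*} [NormedAddCommGroup E] [InnerProductSpace ℝ E]

section BlockTrajectory

variable {P : Params} {e : E} {D : BlockData E}

/-- Coarse position bounds, carrier phase (`k + 1 ≤ K`). -/
theorem pos_bounds_carrier (hP : P.Admissible) (hD : DataOK P e D) (hαs : P.αs ≤ 1) {k : ℕ}
    (hk : k + 1 ≤ P.K) {t : ℝ} (h1 : tHit P e D k ≤ t) (h2 : t < tHit P e D (k + 1)) :
    -(P.r + P.Tmax * P.u) ≤ ⟪pos P e D k t - ((k : ℝ) * P.s) • e, e⟫_ℝ ∧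
      ‖pos P e D k t - ((k : ℝ) * P.s) • e‖ ≤ P.r + P.Tmax * P.u + P.θhi * P.Vhi := by
  have he := hD.e_unit
  have hkK : k ≤ P.K := (Nat.le_succ k).trans hk
  have hform : pos P e D k t - ((k : ℝ) * P.s) • e =
      (D.ξ k + tHit P e D k • D.η k) + (t - tHit P e D k) • (carrier P e D k).W := by
    rw [pos_carrier h1 h2, carrier_p_eq hP hD hkK, base]; abel
  -- the static part
  have hstat : ‖D.ξ k + tHit P e D k • D.η k‖ ≤ P.r + P.Tmax * P.u := by
    rcases Nat.eq_zero_or_pos k with hk0 | hkpos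
    · subst hk0
      simp only [tHit_zero, zero_smul, add_zero]
      have := hP.T_nn; have := hP.u_nn
      exact (hD.ξ_le 0 hkK).trans (by nlinarith)
    · calc ‖D.ξ k + tHit P e D k • D.η k‖ ≤ ‖D.ξ k‖ + ‖tHit P e D k • D.η k‖ := norm_add_le _ _
        _ ≤ P.r + P.Tmax * P.u := by
            refine add_le_add (hD.ξ_le k hkK) ?_
            rw [norm_smul, Real.norm_of_nonneg (tHit_nonneg hP hD hkK)]
            exact mul_le_mul (stepGeom_of_inv hP hD (inv_all hP hD k hkK) hk).t_le_T
              (hD.η_le k hkpos hkK) (norm_nonneg _) hP.T_nn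
  -- the flight part
  have hfl : ‖(t - tHit P e D k) • (carrier P e D k).W‖ ≤ P.θhi * P.Vhi := by
    rw [norm_smul, Real.norm_of_nonneg (sub_nonneg.2 h1)]
    have hθ : t - tHit P e D k ≤ θk P e D k := by rw [tHit_succ] at h2; linarith
    calc (t - tHit P e D k) * ‖(carrier P e D k).W‖ ≤ θk P e D k * ‖(carrier P e D k).W‖ :=
          mul_le_mul_of_nonneg_right hθ (norm_nonneg _)
      _ ≤ P.θhi * P.Vhi := θ_mul_W_le hP hD hk
  have hflin : 0 ≤ ⟪(t - tHit P e D k) • (carrier P e D k).W, e⟫_ℝ := by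
    rw [real_inner_smul_left]
    exact mul_nonneg (sub_nonneg.2 h1) (inner_W_e_nonneg hP hD hαs hkK)
  rw [hform]
  constructor
  · rw [inner_add_left]
    have := neg_norm_le_inner_e he (D.ξ k + tHit P e D k • D.η k)
    linarith
  · exact (norm_add_le _ _).trans (add_le_add hstat hfl)

/-- Coarse position bounds, spent phase (`k + 1 ≤ K`, `t ≤ Tmax`). -/
theorem pos_bounds_spent (hP : P.Admissible) (hD : DataOK P e D) (hαs : P.αs ≤ 1) {k : ℕ}
    (hk : k + 1 ≤ P.K) {t : ℝ} (h2 : tHit P e D (k + 1) ≤ t) (htT : t ≤ P.Tmax) :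
    -P.errA ≤ ⟪pos P e D k t - ((k : ℝ) * P.s) • e, e⟫_ℝ ∧
      ‖pos P e D k t - ((k : ℝ) * P.s) • e‖ ≤ P.fwd := by
  have he := hD.e_unit
  have hkK : k ≤ P.K := (Nat.le_succ k).trans hk
  have h1 : tHit P e D k ≤ t := (tHit_lt_succ hP hD hk).le.trans h2
  have hform : pos P e D k t - ((k : ℝ) * P.s) • e =
      ((D.ξ k + tHit P e D k • D.η k) + θk P e D k • (carrier P e D k).W) +
        (t - tHit P e D (k + 1)) • ρk P e D k := by
    rw [pos_spent h1 h2, qk, carrier_p_eq hP hD hkK, base]; abel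
  have hstat : ‖D.ξ k + tHit P e D k • D.η k‖ ≤ P.r + P.Tmax * P.u := by
    rcases Nat.eq_zero_or_pos k with hk0 | hkpos
    · subst hk0
      simp only [tHit_zero, zero_smul, add_zero]
      have := hP.T_nn; have := hP.u_nn
      exact (hD.ξ_le 0 hkK).trans (by nlinarith)
    · calc ‖D.ξ k + tHit P e D k • D.η k‖ ≤ ‖D.ξ k‖ + ‖tHit P e D k • D.η k‖ := norm_add_le _ _
        _ ≤ P.r + P.Tmax * P.u := by
            refine add_le_add (hD.ξ_le k hkK) ?_
            rw [norm_smul, Real.norm_of_nonneg (tHit_nonneg hP hD hkK)]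
            exact mul_le_mul (stepGeom_of_inv hP hD (inv_all hP hD k hkK) hk).t_le_T
              (hD.η_le k hkpos hkK) (norm_nonneg _) hP.T_nn
  have hfl : ‖θk P e D k • (carrier P e D k).W‖ ≤ P.θhi * P.Vhi := by
    rw [norm_smul, Real.norm_of_nonneg (stepFacts hP hD hk).cont.θ_pos.le]
    exact θ_mul_W_le hP hD hk
  have hflin : 0 ≤ ⟪θk P e D k • (carrier P e D k).W, e⟫_ℝ := by
    rw [real_inner_smul_left]
    exact mul_nonneg (stepFacts hP hD hk).cont.θ_pos.le (inner_W_e_nonneg hP hD hαs hkK)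
  have hdr : ‖(t - tHit P e D (k + 1)) • ρk P e D k‖ ≤ P.Tmax * P.ρs := by
    rw [norm_smul, Real.norm_of_nonneg (sub_nonneg.2 h2)]
    have ht1 : t - tHit P e D (k + 1) ≤ P.Tmax := by
      have := tHit_nonneg hP hD hk; linarith
    exact mul_le_mul ht1 (stepFacts hP hD hk).ρ_le (norm_nonneg _) hP.T_nn
  rw [hform]
  constructor
  · rw [inner_add_left, inner_add_left]
    have h3 := neg_norm_le_inner_e he (D.ξ k + tHit P e D k • D.η k)
    have h4 := neg_norm_le_inner_e he ((t - tHit P e D (k + 1)) • ρk P e D k)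
    unfold Params.errA
    linarith
  · unfold Params.fwd
    calc ‖D.ξ k + tHit P e D k • D.η k + θk P e D k • (carrier P e D k).W +
          (t - tHit P e D (k + 1)) • ρk P e D k‖
        ≤ ‖D.ξ k + tHit P e D k • D.η k + θk P e D k • (carrier P e D k).W‖ +
          ‖(t - tHit P e D (k + 1)) • ρk P e D k‖ := norm_add_le _ _
      _ ≤ (P.r + P.Tmax * P.u + P.θhi * P.Vhi) + P.Tmax * P.ρs := by
          refine add_le_add ((norm_add_le _ _).trans (add_le_add hstat hfl)) hdr
      _ = P.θhi * P.Vhi + (P.r + P.Tmax * P.u) + P.Tmax * P.ρs := by ring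

/-- **Coarse position bounds** on the window `[0, Tmax]`: every sphere whose next transfer is
analysable (`k + 1 ≤ K`), or which is still untouched, stays within `fwd` of its slot and never
falls back by more than `errA`. -/
theorem pos_coarse (hP : P.Admissible) (hD : DataOK P e D) (hαs : P.αs ≤ 1) {k : ℕ} (hk : k ≤ P.K)
    {t : ℝ} (ht0 : 0 ≤ t) (htT : t ≤ P.Tmax) (hph : t < tHit P e D k ∨ k + 1 ≤ P.K) :
    -P.errA ≤ ⟪pos P e D k t - ((k : ℝ) * P.s) • e, e⟫_ℝ ∧
      ‖pos P e D k t - ((k : ℝ) * P.s) • e‖ ≤ P.fwd := by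
  have he := hD.e_unit
  have hr := hP.r_nn; have hu := hP.u_nn; have hT := hP.T_nn; have hρ := hP.ρs_nn
  have hθV : 0 ≤ P.θhi * P.Vhi := mul_nonneg hP.θhi_pos.le hP.Vhi_pos.le
  have hTρ : 0 ≤ P.Tmax * P.ρs := mul_nonneg hT hρ
  have hTu : 0 ≤ P.Tmax * P.u := mul_nonneg hT hu
  by_cases h1 : t < tHit P e D k
  · -- untouched (then `k ≥ 1`)
    have hk1 : 1 ≤ k := by
      rcases Nat.eq_zero_or_pos k with h | h
      · subst h; simp at h1; linarith
      · exact h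
    have hb := pos_bounds_untouched hP hD hk1 hk ht0 htT h1
    refine ⟨?_, ?_⟩
    · have := neg_norm_le_inner_e he (pos P e D k t - ((k : ℝ) * P.s) • e)
      unfold Params.errA; linarith
    · unfold Params.fwd; linarith
  · push Not at h1
    have hk' : k + 1 ≤ P.K := by
      rcases hph with h | h
      · exact absurd h (not_lt.2 h1)
      · exact h
    by_cases h2 : t < tHit P e D (k + 1)
    · have hb := pos_bounds_carrier hP hD hαs hk' h1 h2
      refine ⟨?_, ?_⟩
      · unfold Params.errA; linarith [hb.1]
      · unfold Params.fwd; linarith [hb.2]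
    · push Not at h2
      exact pos_bounds_spent hP hD hαs hk' h2 htT

/-- Separation hypotheses of a block (beyond `Admissible`). -/
structure Params.SepOK (P : Params) : Prop where
  adm : P.Admissible
  αs_le : P.αs ≤ 1
  αn_le : P.αn ≤ 1
  sep2 : P.ε + P.fwd + P.errA < 2 * P.s
  adjSS : P.ε < P.ε * (1 - P.αn ^ 2 / 2) + P.θlo * (P.Vlo + P.u) * (1 - P.αs ^ 2 / 2)
    - 2 * P.Tmax * P.ρs

/-- **Spheres two or more slots apart never touch** on the window. -/
theorem sep_two_apart (hS : P.SepOK) (hD : DataOK P e D) {k l : ℕ} (hkl : k + 2 ≤ l) (hl : l ≤ P.K)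
    {t : ℝ} (ht0 : 0 ≤ t) (htT : t ≤ P.Tmax) (hphk : t < tHit P e D k ∨ k + 1 ≤ P.K)
    (hphl : t < tHit P e D l ∨ l + 1 ≤ P.K) :
    P.ε < ‖pos P e D l t - pos P e D k t‖ := by
  have hP := hS.adm
  have he := hD.e_unit
  have hk : k ≤ P.K := by omega
  have hbk := pos_coarse hP hD hS.αs_le hk ht0 htT hphk
  have hbl := pos_coarse hP hD hS.αs_le hl ht0 htT hphl
  have hdiff : pos P e D l t - pos P e D k t =
      ((l : ℝ) - k) • (P.s • e) + ((pos P e D l t - ((l : ℝ) * P.s) • e) -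
        (pos P e D k t - ((k : ℝ) * P.s) • e)) := by
    rw [sub_smul, smul_smul, smul_smul]; abel
  have hlk : (2 : ℝ) ≤ (l : ℝ) - k := by
    have : ((k : ℝ) + 2) ≤ l := by exact_mod_cast hkl
    linarith
  have hinner : P.ε < ⟪pos P e D l t - pos P e D k t, e⟫_ℝ := by
    rw [hdiff, inner_add_left, inner_sub_left, real_inner_smul_left, real_inner_smul_left,
      real_inner_self_eq_norm_sq, he]
    have h1 := hbl.1
    have h2 := inner_e_le_norm he (pos P e D k t - ((k : ℝ) * P.s) • e)
    have h3 := hbk.2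
    have hs := hP.s_pos
    have hsep := hS.sep2
    nlinarith
  exact hinner.trans_le (inner_e_le_norm he _)


end BlockTrajectory

end BlockAll

end EquilibriumClampedCollisionalWindowLDNegative

end Summit.AtomisticToContinuum.HydrodynamicLimit.Theorems

end
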